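import Literature.Computability.MetaComplexity.Hirahara2020.ReadOnceBranchingPrograms
import HarnessLib

/-!
# Referee F34 made precise: the FIRST rendering's YES side `Hirahara2020.smallBPYes c` is a class
# of juntas, and at every length `2^n` with `n ≥ 2^{c+1}` it omits functions that print's YES side
# `DSPACE(cn)/ₙ cn` contains

Companion of `Hirahara2020/ReadOnceBranchingPrograms.lean` (row R28 of the hardness-magnification
gap census, Hirahara ToC 19(4) 2023 Thm. 1.13, first rendering `thm113` with YES = `smallBPYes c` =
truth tables of functions computed by a deterministic branching program with `≤ c·n/⌊log₂ n⌋`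
nodes) and of the second rendering `Hirahara2020/ReadOnceBranchingProgramsDL.lean` (YES = `dlYes c`,
census D13).  The referee's finding F34 and its wording ruling F36 ("first rendering junta-sized;
second rendering (`DSPACEdl`) faithful up to bounded hardware") were recorded as TEXT; this file
PROVES the first half over the tree's definitions, with no new definition and no named fact:

* `BranchingProgram.eval_congr` / `eval_eq_of_agree_on_vars`: a deterministic branching program's
  value depends only on the variables its nodes query (`Finset.univ.image P.var`, at most `P.size`
  of them, `BranchingProgram.card_vars_le`);
* `Hirahara2020.exists_junta_of_mem_smallBPYes`: every member of `smallBPYes c` is the truth table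
  of a function depending on a set of `≤ c·n/⌊log₂ n⌋` variables;
* `Hirahara2020.juntaBound_lt`: `c·n/⌊log₂ n⌋ < n` as soon as `n ≥ 2^{c+1}`;
* `Hirahara2020.truthTable_not_mem_smallBPYes_of_forall_depends`: hence, for `n ≥ 2^{c+1}`, NO
  function depending on every one of its `n` variables has its truth table in `smallBPYes c` — e.g.
  the `n`-bit conjunction (`truthTable_and_not_mem_smallBPYes`), which is trivially in print's
  `DSPACE(cn)/ₙ cn` (and, for the second rendering, every bounded-hardware linear-space slice is a
  YES instance by `Hirahara2020.truthTable_slice_mem_dlYes`).  So rendering (I)'s YES side is, at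
  all large lengths, STRICTLY smaller than print's: the typed hypothesis of `thm113` is genuinely
  stronger than the printed one (admissible direction, as recorded in the census), which is the
  content of F34.  Nothing here bears on the summit; it is bookkeeping for the census row.
-/

namespace Literature.Computability.MetaComplexity

open Finset

namespace BranchingProgram

variable {n : ℕ}

/-- Inputs agreeing on every queried variable give the same run from any position with any fuel.
[folklore] -/
theorem evalFrom_congr (P : BranchingProgram n) {x y : Fin n → Bool}
    (h : ∀ v : Fin P.m, x (P.var v) = y (P.var v)) :
    ∀ (fuel : ℕ) (s : Fin P.m ⊕ Bool), P.evalFrom x fuel s = P.evalFrom y fuel s := by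
  intro fuel
  induction fuel with
  | zero => intro s; cases s <;> rfl
  | succ fuel ih =>
    intro s
    cases s with
    | inl v => simp only [evalFrom_succ_inl, h v, ih]
    | inr b => simp

/-- **A branching program's value depends only on the variables its nodes query.** [folklore] -/
theorem eval_congr (P : BranchingProgram n) {x y : Fin n → Bool}
    (h : ∀ v : Fin P.m, x (P.var v) = y (P.var v)) : P.eval x = P.eval y := by
  unfold eval
  exact P.evalFrom_congr h _ _

/-- The same with the queried variables packaged as the finite set `univ.image P.var`. [folklore] -/
theorem eval_eq_of_agree_on_vars (P : BranchingProgram n) {x y : Fin n → Bool}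
    (h : ∀ i ∈ (univ : Finset (Fin P.m)).image P.var, x i = y i) : P.eval x = P.eval y :=
  P.eval_congr fun v => h _ (mem_image_of_mem _ (mem_univ v))

/-- A program queries at most `size` distinct variables. [folklore] -/
theorem card_vars_le (P : BranchingProgram n) :
    ((univ : Finset (Fin P.m)).image P.var).card ≤ P.size :=
  card_image_le.trans (by simp [size])

end BranchingProgram

namespace Hirahara2020

/-- **F34, first half (PROVED): the first rendering's YES side consists of juntas.** Every member of
`smallBPYes c` is the truth table of some `f : {0,1}ⁿ → {0,1}` depending only on a set of at most
`c·n/⌊log₂ n⌋` variables. [folklore] -/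
theorem exists_junta_of_mem_smallBPYes {c : ℕ} {x : List Bool} (hx : x ∈ smallBPYes c) :
    ∃ (n : ℕ) (f : (Fin n → Bool) → Bool), x = truthTable f ∧ ∃ S : Finset (Fin n),
      S.card ≤ c * n / Nat.log 2 n ∧ ∀ v w : Fin n → Bool, (∀ i ∈ S, v i = w i) → f v = f w := by
  obtain ⟨n, f, rfl, P, hP, hPf⟩ := hx
  refine ⟨n, f, rfl, (univ : Finset (Fin P.m)).image P.var, P.card_vars_le.trans hP,
    fun v w hvw => ?_⟩
  rw [← hPf v, ← hPf w]
  exact P.eval_eq_of_agree_on_vars hvw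

/-- The junta bound is eventually PROPER: `c·n/⌊log₂ n⌋ < n` once `n ≥ 2^{c+1}`. [folklore] -/
theorem juntaBound_lt {c n : ℕ} (hn : 2 ^ (c + 1) ≤ n) : c * n / Nat.log 2 n < n := by
  have hlog : c + 1 ≤ Nat.log 2 n := Nat.le_log_of_pow_le (by norm_num) hn
  have hn0 : 0 < n := lt_of_lt_of_le (by positivity) hn
  calc c * n / Nat.log 2 n ≤ c * n / (c + 1) := Nat.div_le_div_left hlog (by omega)
    _ < n := by
      rw [Nat.div_lt_iff_lt_mul (by omega)]
      calc c * n < c * n + n := Nat.lt_add_of_pos_right hn0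
        _ = n * (c + 1) := by ring

/-- **No function depending on all of its `n ≥ 2^{c+1}` variables is a YES instance of the first
rendering.** (`hdep i`: flipping coordinate `i` changes `f` somewhere.) [folklore] -/
theorem truthTable_not_mem_smallBPYes_of_forall_depends {c n : ℕ} (hn : 2 ^ (c + 1) ≤ n)
    {f : (Fin n → Bool) → Bool}
    (hdep : ∀ i : Fin n, ∃ v : Fin n → Bool, f v ≠ f (Function.update v i (!v i))) :
    truthTable f ∉ smallBPYes c := by
  rintro ⟨n', g, hx, P, hP, hPg⟩
  have hnn : n = n' := by
    have hl := congrArg List.length hx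
    simp only [length_truthTable] at hl
    exact Nat.pow_right_injective le_rfl hl
  subst hnn
  have hfg : g = f := (truthTable_injective hx).symm
  have hlt : ((univ : Finset (Fin P.m)).image P.var).card < n :=
    (P.card_vars_le.trans hP).trans_lt (juntaBound_lt hn)
  obtain ⟨i, -, hi⟩ : ∃ i ∈ (univ : Finset (Fin n)), i ∉ (univ : Finset (Fin P.m)).image P.var :=
    exists_mem_notMem_of_card_lt_card (by simpa using hlt)
  obtain ⟨v, hv⟩ := hdep i
  apply hv
  rw [← hfg, ← hPg v, ← hPg (Function.update v i (!v i))]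
  exact P.eval_eq_of_agree_on_vars fun j hj =>
    (Function.update_of_ne (by rintro rfl; exact hi hj) _ _).symm

/-- **Example: the `n`-bit conjunction** (`n ≥ 2^{c+1}`) — in print's YES side `DSPACE(cn)/ₙ cn`
trivially, NOT in the first rendering's `smallBPYes c`. [folklore] -/
theorem truthTable_and_not_mem_smallBPYes {c n : ℕ} (hn : 2 ^ (c + 1) ≤ n) :
    truthTable (fun v : Fin n → Bool => decide (∀ i, v i = true)) ∉ smallBPYes c := by
  refine truthTable_not_mem_smallBPYes_of_forall_depends hn fun i => ⟨fun _ => true, ?_⟩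
  have h1 : (decide (∀ j : Fin n, (fun _ : Fin n => true) j = true)) = true := by simp
  have h2 : (decide (∀ j : Fin n, Function.update (fun _ : Fin n => true) i (!true) j = true))
      = false := by
    simp only [Bool.not_true, decide_eq_false_iff_not, not_forall]
    exact ⟨i, by simp⟩
  rw [h1, h2]
  decide

/-- Hence, for every `c`, at every length `2^n` with `n ≥ 2^{c+1}` some truth table of that length
lies outside the first rendering's YES side (the witness behind F34's "fewer YES instances than
print"). [folklore] -/
theorem exists_truthTable_not_mem_smallBPYes (c : ℕ) {n : ℕ} (hn : 2 ^ (c + 1) ≤ n) :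
    ∃ f : (Fin n → Bool) → Bool, truthTable f ∉ smallBPYes c :=
  ⟨_, truthTable_and_not_mem_smallBPYes hn⟩

end Hirahara2020

end Literature.Computability.MetaComplexity
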